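import Summits.BirchSwinnertonDyer.BirchSwinnertonDyer.Theorems.ManinLocalTwoThreeShimuraKernelBlindNecessary
import Summits.BirchSwinnertonDyer.Rank1Residual.ManinAdditive.ShimuraKernelHolds
import HarnessLib

/-!
# THE `2`-ADIC Γ₀/Γ₁ DEFECT LAW as an IFF: `|c₀| = 2|c₁|` ⟺ Shimura index `4`, or index `2` with a NON-blind kernel point

Summit `BirchSwinnertonDyer`, route `ManinLocalTwoThree` (cell bsd-f2-manin), deciding crux C2 `ManinOddAtFour`
(stmt-BirchSwinnertonDyer-22967); lead p1 gen 14.  The cell's SEARCH QUESTION («which local invariant at `2` controls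
`ord₂ c_E` for additive reduction») at the Γ₀/Γ₁ interface: for the optimal `X₁(N)`/`X₀(N)` pair `(D₁, D₀)` of a class at `4 ∣ N`
(globally minimal models, `W₀ = [0, a₂, 0, a₄, a₆]`, same newform `f`, `2Λ₀(f) ⊆ Λ₁(f) ⊆ Λ₀(f)`), the tree's ledger gives
`|c₀| ∈ {|c₁|, 2|c₁|}` (`natAbs_maninConstant₀_eq_or_eq_two_mul_of_four_dvd_level`).  an's answer (MEMO-an §76) was
`δ := ord₂ c₀ − ord₂ c₁ = [s = 4] + [s = 2 ∧ T_V non-blind]`, `s = [Λ₀(f) : Λ₁(f)]`, `T_V = ℘(c₀w/2)` the kernel point; the tree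
held ONE direction (`kernelToLedgerEdge_holds`: `δ = 1 ⟹ s = 4 ∨ T_V non-blind`).  With the converse Vélu step
(`shimuraKernelBlindAt_of_natAbs_eq`, this gen) the law is an IFF:

* `natAbs_maninConstant₀_eq_two_mul_iff_index_four_or_nonblind` — **`|c₀| = 2|c₁|` ⟺ `Λ₁(f) = 2Λ₀(f)` ∨
  (`Λ₁(f) ≠ Λ₀(f)` ∧ every `w ∈ Λ₁(f) ∖ 2Λ₀(f)` has a kernel point `℘(c₀w/2)` that is NOT (rational, integral and) Kummer-blind).**
* `natAbs_maninConstant₀_eq_iff_index_ne_four_and_blind` — the contrapositive reading for `|c₀| = |c₁|`.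
* `shimuraTrivialOfNoBlindAtFour_of_transfer` / `…_of_body` — **E-an-151 ⟹ E-an-153** and **C2 ⟹ E-an-153** (mod F-need): an
  optimal `W₀` without blind rational `2`-torsion has `Λ₁(f) = Λ₀(f)`.  So C2 forces all three kernel rows E-an-152/152b/153.

So on `a₁ = a₃ = 0` models the `2`-adic Γ₀/Γ₁ defect is EXACTLY the pair (Shimura index, Kummer-blindness of the kernel point):
a theorem, not a law.  HONEST FRAMING: which alternative HOLDS for a given class (E-an-151/152/152b) stays OPEN; no Manin constant
is decided; C2, Manin's conjecture and BSD are not proved by this.  No definitions, no named facts, no sorry.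
-/

set_option autoImplicit false
-- the summit-side namespace `Summit.BirchSwinnertonDyer.BirchSwinnertonDyer.…` is the tree's (summit = sub-problem)
set_option linter.dupNamespace false

noncomputable section

open WeierstrassCurve Literature.NumberTheory.EllipticCurves Literature.NumberTheory.EllipticCurves.ModularForms
open CongruenceSubgroup
open Summit.BirchSwinnertonDyer.Rank1Residual.ManinAdditive.ShimuraLedger
open Summit.BirchSwinnertonDyer.Rank1Residual.ManinAdditive.CuspidalKummer
open Summit.BirchSwinnertonDyer.Rank1Residual.ManinAdditive.ShimuraKernel

namespace Summit.BirchSwinnertonDyer.BirchSwinnertonDyer.Theorems.ManinLocalTwoThree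

variable {W₁ W₀ : WeierstrassCurve ℚ} [W₁.IsElliptic] [W₁.IsGloballyMinimal] [W₀.IsElliptic]
  [W₀.IsGloballyMinimal] {N : ℕ} [NeZero N]

/-- **Doubled ⟹ the kernel point is NOT blind** (pointwise form of `kernelToLedgerEdge_holds`): for the optimal pair at `4 ∣ N`
with `|c₀| = 2|c₁|`, outside the index-`4` configuration, NO `w ∈ Λ₁(f) ∖ 2Λ₀(f)` carries rational integral Kummer-blind
kernel-point data (the Vélu step `false_of_blind_halfPeriod_neronLattice` on `Λ_{E₀} ⊆ Λ_{E₁} ⊆ ½Λ_{E₀}`). -/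
theorem not_kernelPointBlind_of_natAbs_eq_two_mul (D₁ : Gamma1ParametrizationData W₁ N)
    (D₀ : ModularParametrizationData W₀ N) (hiso : IsIsogenous W₁ W₀) (h₁ : D₁.IsOptimal)
    (h₀ : ∀ z ∈ D₀.L.lattice, ∃ w ∈ periodLattice D₀.f, z = D₀.c * w) (h4 : 2 ^ 2 ∣ N)
    (ha₁ : W₀.a₁ = 0) (ha₃ : W₀.a₃ = 0) (hdouble : D₀.maninConstant.natAbs = 2 * D₁.maninConstant.natAbs)
    (hne4 : ¬ (∀ z : ℂ, z ∈ periodLatticeGamma1 D₀.f ↔ ∃ w ∈ periodLattice D₀.f, z = 2 * w))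
    {w : ℂ} (hw : w ∈ periodLatticeGamma1 D₀.f) (hw2 : ∀ v ∈ periodLattice D₀.f, w ≠ 2 * v) :
    ¬ ∃ A₂ A₄ E : ℤ, (A₂ : ℚ) = W₀.a₂ ∧ (A₄ : ℚ) = W₀.a₄ ∧
      (E : ℚ) ^ 3 + W₀.a₂ * (E : ℚ) ^ 2 + W₀.a₄ * E + W₀.a₆ = 0 ∧
      D₀.L.weierstrassP ((D₀.c : ℂ) * w / 2) = (((E : ℚ) + W₀.a₂ / 3 : ℚ) : ℂ) ∧ KummerBlindAtTwo A₂ A₄ E := by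
  rintro ⟨A₂, A₄, E, hA₂, hA₄, heE, hxE, hbl⟩
  have hf : D₁.f = D₀.f := D₁.f_eq_of_isIsogenous D₀ hiso
  have hc₁ : (D₁.c : ℂ) ≠ 0 := by exact_mod_cast D₁.maninConstant_ne_zero
  have hc₀ : (D₀.c : ℂ) ≠ 0 := by exact_mod_cast D₀.maninConstant_ne_zero_holds
  -- `c₀ = ε · 2c₁`
  obtain ⟨ε, hε, hcc⟩ : ∃ ε : ℂ, (ε = 1 ∨ ε = -1) ∧ (D₀.c : ℂ) = ε * (2 * D₁.c) := by
    have h : D₀.maninConstant.natAbs = (2 * D₁.maninConstant).natAbs := by rw [hdouble, Int.natAbs_mul]; rfl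
    rcases Int.natAbs_eq_natAbs_iff.mp h with h' | h'
    · exact ⟨1, Or.inl rfl, by rw [one_mul]; exact_mod_cast h'⟩
    · exact ⟨-1, Or.inr rfl, by rw [neg_one_mul]; exact_mod_cast h'⟩
  have hε2 : ε * ε = 1 := by rcases hε with rfl | rfl <;> norm_num
  have hεmem : ∀ (S : AddSubgroup ℂ) (y : ℂ), y ∈ S → ε * y ∈ S := by
    intro S y hy; rcases hε with rfl | rfl
    · rwa [one_mul]
    · rw [neg_one_mul]; exact neg_mem hy
  -- Ling–Oesterlé
  have h2Λ : ∀ v ∈ periodLattice D₀.f, (2 : ℂ) * v ∈ periodLatticeGamma1 D₀.f := fun v hv ↦ by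
    have h := pMulLatticeLeGamma1OfTracelessPrime_holds N D₀.f D₀.isNewformOf.1 2 Nat.prime_two
      ((dvd_pow_self 2 two_ne_zero).trans h4) (D₀.isNewformOf.1.cuspCoeff_eq_zero_of_sq_dvd Nat.prime_two h4) v hv
    exact_mod_cast h
  -- `Λ_{E₀} ⊆ Λ_{E₁} ⊆ ½Λ_{E₀}`
  have hle : D₀.L.lattice ≤ D₁.L.lattice := by
    intro z hz
    obtain ⟨v, hv, rfl⟩ := h₀ z hz
    have h2v : ε * ((2 : ℂ) * v) ∈ periodLatticeGamma1 D₁.f := by rw [hf]; exact hεmem _ _ (h2Λ v hv)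
    have e : (D₀.c : ℂ) * v = (D₁.c : ℂ) * (ε * (2 * v)) := by rw [hcc]; ring
    rw [e]
    exact D₁.smul_periodLatticeGamma1_le _ h2v
  have htwo : ∀ y ∈ D₁.L.lattice, 2 * y ∈ D₀.L.lattice := by
    intro y hy
    obtain ⟨w₁, hw₁, rfl⟩ := h₁ y hy
    have hw₀ : ε * w₁ ∈ periodLattice D₀.f := hεmem _ _ (hf ▸ periodLatticeGamma1_le_periodLattice D₁.f hw₁)
    have e : 2 * ((D₁.c : ℂ) * w₁) = (D₀.c : ℂ) * (ε * w₁) := by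
      rw [hcc]; linear_combination -(2 * (D₁.c : ℂ) * w₁) * hε2
    rw [e]
    exact D₀.smul_periodLattice_le _ hw₀
  -- the kernel point `z₀ = c₀w/2 = ε c₁ w`
  set z₀ : ℂ := (D₀.c : ℂ) * w / 2 with hz₀def
  have hz₀' : z₀ ∈ D₁.L.lattice := by
    rw [show z₀ = (D₁.c : ℂ) * (ε * w) by rw [hz₀def, hcc]; ring]
    exact D₁.smul_periodLatticeGamma1_le _ (by rw [hf]; exact hεmem _ _ hw)
  have hz₀ : z₀ ∉ D₀.L.lattice := by
    intro h
    obtain ⟨v, hv, hv'⟩ := h₀ _ h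
    refine hw2 v hv (mul_left_cancel₀ hc₀ ?_)
    linear_combination (2 : ℂ) * hv'
  have h2z₀ : 2 * z₀ ∈ D₀.L.lattice := htwo z₀ hz₀'
  rcases halfLattice_trichotomy D₀.L D₁.L hle htwo with hcase | hcase | hcase
  · -- `Λ_{E₁} = Λ_{E₀}`: the index-`4` configuration
    apply hne4
    intro z
    constructor
    · intro hz
      have hz' : (D₁.c : ℂ) * z ∈ D₀.L.lattice := hcase _ (D₁.smul_periodLatticeGamma1_le z (hf ▸ hz))
      obtain ⟨v, hv, hv'⟩ := h₀ _ hz'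
      refine ⟨ε * v, hεmem _ _ hv, ?_⟩
      have h : (D₁.c : ℂ) * z = (D₁.c : ℂ) * (2 * (ε * v)) := by rw [hv', hcc]; ring
      exact mul_left_cancel₀ hc₁ h
    · rintro ⟨v, hv, rfl⟩
      exact h2Λ v hv
  · -- `Λ_{E₁} ⊇ ½Λ_{E₀}`: then `Λ₁ = Λ₀`, contradicting doubling
    have hΛ : periodLatticeGamma1 D₀.f = periodLattice D₀.f := by
      refine le_antisymm (periodLatticeGamma1_le_periodLattice D₀.f) fun v hv ↦ ?_
      have h2h : 2 * (ε * ((D₁.c : ℂ) * v)) ∈ D₀.L.lattice := by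
        have e : 2 * (ε * ((D₁.c : ℂ) * v)) = (D₀.c : ℂ) * v := by rw [hcc]; ring
        rw [e]; exact D₀.smul_periodLattice_le v hv
      obtain ⟨w₁, hw₁, hw₁'⟩ := h₁ _ (hcase _ h2h)
      have hv' : v = ε * w₁ := by
        have h : (D₁.c : ℂ) * v = (D₁.c : ℂ) * (ε * w₁) := by
          linear_combination ε * hw₁' - ((D₁.c : ℂ) * v) * hε2
        exact mul_left_cancel₀ hc₁ h
      rw [hv', ← hf]; exact hεmem _ _ hw₁
    have heq := natAbs_maninConstant₀_eq_of_periodLatticeGamma1_eq_periodLattice D₁ D₀ h₁ h₀ hf hΛ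
    have hne : D₁.maninConstant.natAbs ≠ 0 := Int.natAbs_ne_zero.mpr D₁.maninConstant_ne_zero
    omega
  · -- index 2 with `Λ_{E₁} = Λ_{E₀} + ℤz₀`: the Vélu step refutes the blind data
    obtain ⟨z₁, hz₁', hz₁, hidx₁⟩ := hcase
    have hzz : z₀ - z₁ ∈ D₀.L.lattice := (hidx₁ z₀ hz₀').resolve_left hz₀
    have hidx : ∀ y ∈ D₁.L.lattice, y ∈ D₀.L.lattice ∨ y - z₀ ∈ D₀.L.lattice := by
      intro y hy
      rcases hidx₁ y hy with h | h
      · exact Or.inl h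
      · right
        have e' : y - z₀ = (y - z₁) - (z₀ - z₁) := by ring
        rw [e']; exact sub_mem h hzz
    exact false_of_blind_halfPeriod_neronLattice ha₁ ha₃ D₀.isNeronLattice D₁.isNeronLattice hA₂ hA₄ heE hbl
      hz₀ h2z₀ hxE hle hz₀' hidx

/-- **THE `2`-ADIC Γ₀/Γ₁ DEFECT LAW (iff).**  For the optimal `X₁(N)`-datum `D₁` and a lattice-optimal `X₀(N)`-datum `D₀` of two
isogenous globally minimal curves, `W₀ = [0, a₂, 0, a₄, a₆]`, `4 ∣ N`:
`|c₀| = 2|c₁|` **iff** EITHER the Shimura index is `4` (`Λ₁(f) = 2Λ₀(f)`) OR the index is `2` (`Λ₁(f) ≠ Λ₀(f)`) and no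
`w ∈ Λ₁(f) ∖ 2Λ₀(f)` has a Kummer-blind kernel point `℘(c₀w/2)` (rational integral blind data in the sense of E-an-152).
(`⟸`: index `4` doubles by E-an-68 `natAbs_maninConstant₀_eq_two_mul_of_index_four`; at index `2`, were the constants undoubled,
`shimuraKernelBlindAt_of_natAbs_eq` would produce blind data.  `⟹`: `not_kernelPointBlind_of_natAbs_eq_two_mul`.) -/
theorem natAbs_maninConstant₀_eq_two_mul_iff_index_four_or_nonblind (D₁ : Gamma1ParametrizationData W₁ N)
    (D₀ : ModularParametrizationData W₀ N) (hiso : IsIsogenous W₁ W₀) (h₁ : D₁.IsOptimal)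
    (h₀ : ∀ z ∈ D₀.L.lattice, ∃ w ∈ periodLattice D₀.f, z = D₀.c * w) (h4 : 2 ^ 2 ∣ N)
    (ha₁ : W₀.a₁ = 0) (ha₃ : W₀.a₃ = 0) :
    D₀.maninConstant.natAbs = 2 * D₁.maninConstant.natAbs ↔
      ((∀ z : ℂ, z ∈ periodLatticeGamma1 D₀.f ↔ ∃ w ∈ periodLattice D₀.f, z = 2 * w) ∨
        (periodLatticeGamma1 D₀.f ≠ periodLattice D₀.f ∧
          ∀ w ∈ periodLatticeGamma1 D₀.f, (∀ v ∈ periodLattice D₀.f, w ≠ 2 * v) →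
            ¬ ∃ A₂ A₄ E : ℤ, (A₂ : ℚ) = W₀.a₂ ∧ (A₄ : ℚ) = W₀.a₄ ∧
              (E : ℚ) ^ 3 + W₀.a₂ * (E : ℚ) ^ 2 + W₀.a₄ * E + W₀.a₆ = 0 ∧
              D₀.L.weierstrassP ((D₀.c : ℂ) * w / 2) = (((E : ℚ) + W₀.a₂ / 3 : ℚ) : ℂ) ∧ KummerBlindAtTwo A₂ A₄ E)) := by
  have hf : D₁.f = D₀.f := D₁.f_eq_of_isIsogenous D₀ hiso
  have hne : D₁.maninConstant.natAbs ≠ 0 := Int.natAbs_ne_zero.mpr D₁.maninConstant_ne_zero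
  have h2Λ : ∀ v ∈ periodLattice D₀.f, (2 : ℂ) * v ∈ periodLatticeGamma1 D₀.f := fun v hv ↦ by
    have h := pMulLatticeLeGamma1OfTracelessPrime_holds N D₀.f D₀.isNewformOf.1 2 Nat.prime_two
      ((dvd_pow_self 2 two_ne_zero).trans h4) (D₀.isNewformOf.1.cuspCoeff_eq_zero_of_sq_dvd Nat.prime_two h4) v hv
    exact_mod_cast h
  constructor
  · intro hdouble
    by_cases hidx4 : ∀ z : ℂ, z ∈ periodLatticeGamma1 D₀.f ↔ ∃ w ∈ periodLattice D₀.f, z = 2 * w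
    · exact Or.inl hidx4
    · refine Or.inr ⟨fun hΛ ↦ ?_, fun w hw hw2 ↦ ?_⟩
      · have heq := natAbs_maninConstant₀_eq_of_periodLatticeGamma1_eq_periodLattice D₁ D₀ h₁ h₀ hf hΛ
        omega
      · exact not_kernelPointBlind_of_natAbs_eq_two_mul D₁ D₀ hiso h₁ h₀ h4 ha₁ ha₃ hdouble hidx4 hw hw2
  · rintro (hidx4 | ⟨hΛne, hnb⟩)
    · exact natAbs_maninConstant₀_eq_two_mul_of_index_four D₁ D₀ h₁ h₀ (fun z ↦ by rw [hf]; exact hidx4 z)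
    · rcases natAbs_maninConstant₀_eq_or_eq_two_mul_of_four_dvd_level D₁ D₀ hiso h₁ h₀ h4 with heq | hdouble
      · -- undoubled: either `Λ₁ ⊆ 2Λ₀` (index `4`, doubled after all) or a blind kernel point exists — contradiction
        by_cases hsub : ∀ w ∈ periodLatticeGamma1 D₀.f, ∃ v ∈ periodLattice D₀.f, w = 2 * v
        · exact natAbs_maninConstant₀_eq_two_mul_of_index_four D₁ D₀ h₁ h₀ (fun z ↦ by
            rw [hf]; exact ⟨hsub z, by rintro ⟨v, hv, rfl⟩; exact h2Λ v hv⟩)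
        · exfalso
          push Not at hsub
          obtain ⟨w, hw, hw2⟩ := hsub
          exact hnb w hw hw2 (shimuraKernelBlindAt_of_natAbs_eq D₁ D₀ hiso h₁ h₀ h4 ha₁ ha₃ heq hΛne hw hw2)
      · exact hdouble

/-- **The undoubled reading**: `|c₀| = |c₁|` iff the Shimura index is not `4` and (the index is `1`, or some
`w ∈ Λ₁(f) ∖ 2Λ₀(f)` has a rational integral Kummer-BLIND kernel point).  Contrapositive bookkeeping of the iff above with the
ledger dichotomy `|c₀| ∈ {|c₁|, 2|c₁|}`. -/
theorem natAbs_maninConstant₀_eq_iff_index_ne_four_and_blind (D₁ : Gamma1ParametrizationData W₁ N)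
    (D₀ : ModularParametrizationData W₀ N) (hiso : IsIsogenous W₁ W₀) (h₁ : D₁.IsOptimal)
    (h₀ : ∀ z ∈ D₀.L.lattice, ∃ w ∈ periodLattice D₀.f, z = D₀.c * w) (h4 : 2 ^ 2 ∣ N)
    (ha₁ : W₀.a₁ = 0) (ha₃ : W₀.a₃ = 0) :
    D₀.maninConstant.natAbs = D₁.maninConstant.natAbs ↔
      (¬ (∀ z : ℂ, z ∈ periodLatticeGamma1 D₀.f ↔ ∃ w ∈ periodLattice D₀.f, z = 2 * w) ∧
        (periodLatticeGamma1 D₀.f = periodLattice D₀.f ∨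
          ∃ w ∈ periodLatticeGamma1 D₀.f, (∀ v ∈ periodLattice D₀.f, w ≠ 2 * v) ∧
            ∃ A₂ A₄ E : ℤ, (A₂ : ℚ) = W₀.a₂ ∧ (A₄ : ℚ) = W₀.a₄ ∧
              (E : ℚ) ^ 3 + W₀.a₂ * (E : ℚ) ^ 2 + W₀.a₄ * E + W₀.a₆ = 0 ∧
              D₀.L.weierstrassP ((D₀.c : ℂ) * w / 2) = (((E : ℚ) + W₀.a₂ / 3 : ℚ) : ℂ) ∧ KummerBlindAtTwo A₂ A₄ E)) := by
  have hne : D₁.maninConstant.natAbs ≠ 0 := Int.natAbs_ne_zero.mpr D₁.maninConstant_ne_zero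
  have key := natAbs_maninConstant₀_eq_two_mul_iff_index_four_or_nonblind D₁ D₀ hiso h₁ h₀ h4 ha₁ ha₃
  rcases natAbs_maninConstant₀_eq_or_eq_two_mul_of_four_dvd_level D₁ D₀ hiso h₁ h₀ h4 with heq | hdouble
  · -- undoubled: the right side of `key` fails
    have hR : ¬ ((∀ z : ℂ, z ∈ periodLatticeGamma1 D₀.f ↔ ∃ w ∈ periodLattice D₀.f, z = 2 * w) ∨
        (periodLatticeGamma1 D₀.f ≠ periodLattice D₀.f ∧
          ∀ w ∈ periodLatticeGamma1 D₀.f, (∀ v ∈ periodLattice D₀.f, w ≠ 2 * v) →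
            ¬ ∃ A₂ A₄ E : ℤ, (A₂ : ℚ) = W₀.a₂ ∧ (A₄ : ℚ) = W₀.a₄ ∧
              (E : ℚ) ^ 3 + W₀.a₂ * (E : ℚ) ^ 2 + W₀.a₄ * E + W₀.a₆ = 0 ∧
              D₀.L.weierstrassP ((D₀.c : ℂ) * w / 2) = (((E : ℚ) + W₀.a₂ / 3 : ℚ) : ℂ) ∧ KummerBlindAtTwo A₂ A₄ E)) := by
      intro h; have := key.mpr h; omega
    have h4' : ¬ (∀ z : ℂ, z ∈ periodLatticeGamma1 D₀.f ↔ ∃ w ∈ periodLattice D₀.f, z = 2 * w) :=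
      fun h ↦ hR (Or.inl h)
    refine ⟨fun _ ↦ ⟨h4', ?_⟩, fun _ ↦ heq⟩
    by_cases hΛ : periodLatticeGamma1 D₀.f = periodLattice D₀.f
    · exact Or.inl hΛ
    · right
      by_contra hcon
      apply hR
      refine Or.inr ⟨hΛ, fun w hw hw2 hdata ↦ hcon ⟨w, hw, hw2, hdata⟩⟩
  · -- doubled: the left side fails, and so does the right side
    have hL : D₀.maninConstant.natAbs ≠ D₁.maninConstant.natAbs := by omega
    refine ⟨fun h ↦ absurd h hL, fun ⟨h4', h⟩ ↦ ?_⟩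
    exfalso
    rcases key.mp hdouble with hidx4 | ⟨hΛne, hnb⟩
    · exact h4' hidx4
    · rcases h with hΛ | ⟨w, hw, hw2, hdata⟩
      · exact hΛne hΛ
      · exact hnb w hw hw2 hdata


/-! ## E-an-153 is necessary too -/

omit [W₁.IsElliptic] [W₁.IsGloballyMinimal] [W₀.IsElliptic] [W₀.IsGloballyMinimal] [NeZero N] in
/-- **E-an-151 ⟹ E-an-153** (through F-need): if the optimal pair of every class at `4 ∣ N` has `|c₀| = |c₁|`, then an optimal
`W₀ = [0, a₂, 0, a₄, a₆]` WITHOUT a Kummer-blind rational `2`-torsion point has trivial Shimura kernel, `Λ₁(f) = Λ₀(f)` — at index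
`4` the constants would be doubled (E-an-68), and at index `2` the kernel point would be a blind rational `2`-torsion point
(`shimuraKernelBlindAt_of_natAbs_eq`). -/
theorem shimuraTrivialOfNoBlindAtFour_of_transfer (hex : exists_optimal_gamma1ParametrizationData)
    (h151 : GammaOneTransferAtFour) : ShimuraTrivialOfNoBlindAtFour := by
  intro W₀ _ _ N _ D₀ h₀ h4 ha₁ ha₃ hnobl
  by_contra hΛne
  obtain ⟨W₁, _, _, D₁, hiso, h₁⟩ := hex W₀ D₀ h₀
  have hf : D₁.f = D₀.f := D₁.f_eq_of_isIsogenous D₀ hiso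
  have heq := h151 W₁ W₀ D₁ D₀ hiso h₁ h₀ h4
  have hne : D₁.maninConstant.natAbs ≠ 0 := Int.natAbs_ne_zero.mpr D₁.maninConstant_ne_zero
  have h2Λ : ∀ v ∈ periodLattice D₀.f, (2 : ℂ) * v ∈ periodLatticeGamma1 D₀.f := fun v hv ↦ by
    have h := pMulLatticeLeGamma1OfTracelessPrime_holds N D₀.f D₀.isNewformOf.1 2 Nat.prime_two
      ((dvd_pow_self 2 two_ne_zero).trans h4) (D₀.isNewformOf.1.cuspCoeff_eq_zero_of_sq_dvd Nat.prime_two h4) v hv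
    exact_mod_cast h
  by_cases hsub : ∀ w ∈ periodLatticeGamma1 D₀.f, ∃ v ∈ periodLattice D₀.f, w = 2 * v
  · -- index `4`: doubled, contradicting the transfer
    have hdouble := natAbs_maninConstant₀_eq_two_mul_of_index_four D₁ D₀ h₁ h₀ (fun z ↦ by
      rw [hf]; exact ⟨hsub z, by rintro ⟨v, hv, rfl⟩; exact h2Λ v hv⟩)
    omega
  · push Not at hsub
    obtain ⟨w, hw, hw2⟩ := hsub
    obtain ⟨A₂, A₄, E, hA₂, hA₄, heE, -, hbl⟩ :=
      shimuraKernelBlindAt_of_natAbs_eq D₁ D₀ hiso h₁ h₀ h4 ha₁ ha₃ heq hΛne hw hw2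
    exact hnobl A₂ A₄ E hA₂ hA₄ heE hbl

omit [W₁.IsElliptic] [W₁.IsGloballyMinimal] [W₀.IsElliptic] [W₀.IsGloballyMinimal] [NeZero N] in
/-- **C2-body ⟹ E-an-153** (through F-need).  With `shimuraKernelBlindAtFour_of_body` and `shimuraIndexNeFour_of_body`: modulo F-need,
C2 forces ALL THREE kernel rows E-an-152, E-an-152b, E-an-153 (and, by `kernelToLedgerEdge_holds` / `transfer_of_shimuraTrivial`,
they give the transfer back on `a₁ = a₃ = 0` models). -/
theorem shimuraTrivialOfNoBlindAtFour_of_body (hex : exists_optimal_gamma1ParametrizationData) (h : ManinOddAtFourBody) :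
    ShimuraTrivialOfNoBlindAtFour :=
  shimuraTrivialOfNoBlindAtFour_of_transfer hex (gammaOneTransferAtFour_of_body h)

end Summit.BirchSwinnertonDyer.BirchSwinnertonDyer.Theorems.ManinLocalTwoThree

end
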